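import Summits.BirchSwinnertonDyer.BirchSwinnertonDyer.Theses.ClassRecordThree
import Summits.BirchSwinnertonDyer.BirchSwinnertonDyer.Theses.KolyvaginRoadThree
import Literature.NumberTheory.GaloisCohomology.PoitouTateFiniteShaDualityHolds
import HarnessLib

/-!
# Item 23176 `PoitouTateShaTateDualFact` of routes `ClassRecordThree` ∕ `KolyvaginRoadThree` — PROVED BY NAME (transfer of the solved
# sibling `UniversalToricDescent`'s item 20462; engine = the Literature theorem `poitouTate_sha_tateDual_holds`)

Seat `bsd-idea-10` g26 (ideator, lens = transfer; write-cruxes 19109 ∕ 19106; `--supports stmt-BirchSwinnertonDyer-19109 --as helper`).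

THE TRANSFER. Route item stmt-BirchSwinnertonDyer-23176 (`aside`, rank 9, OPEN; it is the binder `hPT2` of the registered zero-stub skeleton
`Cruxes/EulerHalvesAtThree/Lines/inert.lean` r26 of crux 19109 `EulerHalvesAtThree` and of the items-closers r21 (p657849) ∕ r24 ∕
`EulerHalvesResidualUB.eulerHalvesAtThree_of_items_of_residualUpperBound` (p665485)) has the statement
    `∀ (K : Type) [Field K] [NumberField K], Literature.NumberTheory.GaloisCohomology.poitouTate_sha_tateDual K`
(Poitou–Tate duality: `Ш¹(K, M^D)` and `Ш²(K, M)` finite and perfectly paired for every finite Galois module `M` over a number field `K`;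
Milne *ADT* I Thm. 4.10 (a), Harari Thm. 17.13 (b), Tate ICM 1962 Thm. 3.1). The SAME statement is item stmt-BirchSwinnertonDyer-20462 of the
sibling route `UniversalToricDescent`, CLOSED `proved` (`Theorems.poitouTateShaTateDualFact_proof`, via
`Theorems.PoitouTateShaTwoReadout.poitouTate_sha_tateDual_numberField`); and the named fact itself is DISCHARGED route-independently in
`Literature/NumberTheory/GaloisCohomology/PoitouTateFiniteShaDualityHolds.lean` (Poitou–Tate for finite modules 7∕7, re-homed proofs) as
`Literature.NumberTheory.GaloisCohomology.poitouTate_sha_tateDual_holds (K) : poitouTate_sha_tateDual K` (Milne's proof from the idèle class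
formation: `poitouTate_sha_tateDual_of_R4` fed with the idèle-projection bridge `hR4_ideleProjection`). This file CITES that Literature theorem for
the two route decls of item 23176 (importing no other route's file):

* `classRecordThree_poitouTateShaTateDualFact : Theses.ClassRecordThree.PoitouTateShaTateDualFact` (TYPE = the CR3 route decl verbatim);
* `kolyvaginRoadThree_poitouTateShaTateDualFact : Theses.KolyvaginRoadThree.PoitouTateShaTateDualFact` (the KR3 twin decl of the same item).

CONSEQUENCE for crux 19109 (not enacted here): the inert closer ∕ the registered `Lines/inert.lean` r26 `EulerHalvesAtThree_of` reads on SEVEN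
route items BY NAME (r26's eight minus 23176) after substituting `hPT2 := classRecordThree_poitouTateShaTateDualFact`; a seven-binder re-thread
is offered to the route pen as an r27 CANDIDATE of the Cruxes-side skeleton (this seat registers nothing, W-79) and is deliberately NOT placed in
`Theorems/`.

HONEST FRAMING: theorems only (no definition, no named fact, no instance, no notation, no `sorry`; axioms = the standard trio); the only thing
PROVED is a published theorem (Poitou–Tate duality) in the tree's currency, by citing a Literature theorem; crux 19109 does NOT close by this file
and no closer of it is stated here; nothing is asserted about any curve; BSD is proved for no curve; no census word, tier or label moves (T7).
The registered skeleton `Lines/inert.lean` r26 is NOT touched (W-79).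

References: [MilneADT2006] J. S. Milne, *Arithmetic duality theorems* (2nd ed., 2006), Ch. I, Thm. 4.10 (a) (proof p. 58), Lemma 4.13;
[Harari2020] D. Harari, *Galois cohomology and class field theory* (2020), Thm. 17.13 (b); [Tate1963DualityICM] J. Tate, *Duality theorems in
Galois cohomology over number fields*, Proc. ICM Stockholm 1962 (1963), Thm. 3.1; [CasselsFrohlichANT1967] Ch. VII § 11.2 (bis).
-/

set_option linter.dupNamespace false
set_option autoImplicit false

noncomputable section

namespace Summit.BirchSwinnertonDyer.BirchSwinnertonDyer.Theorems.EulerHalvesPT2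

/-! ## Item 23176 by name (both route decls) -/

/-- **Item 23176 `PoitouTateShaTateDualFact` of route `ClassRecordThree`, BY NAME** — Poitou–Tate duality (`Ш¹(K, M^D)` and `Ш²(K, M)`
finite and perfectly paired) for every finite Galois module over every number field `K`, cited from the Literature theorem
`Literature.NumberTheory.GaloisCohomology.poitouTate_sha_tateDual_holds` (the statement closed as item 20462 on the sibling route
`UniversalToricDescent`). [cite: MilneADT2006, Ch. I, Thm. 4.10 (a)] [cite: Harari2020, Thm. 17.13 (b)] [cite: Tate1963DualityICM, Thm. 3.1] -/
theorem classRecordThree_poitouTateShaTateDualFact :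
    Summit.BirchSwinnertonDyer.BirchSwinnertonDyer.Theses.ClassRecordThree.PoitouTateShaTateDualFact :=
  fun K _ _ => Literature.NumberTheory.GaloisCohomology.poitouTate_sha_tateDual_holds K

/-- **Item 23176 `PoitouTateShaTateDualFact` — the `KolyvaginRoadThree` decl of the same item, BY NAME.**
[cite: MilneADT2006, Ch. I, Thm. 4.10 (a)] [cite: Harari2020, Thm. 17.13 (b)] [cite: Tate1963DualityICM, Thm. 3.1] -/
theorem kolyvaginRoadThree_poitouTateShaTateDualFact :
    Summit.BirchSwinnertonDyer.BirchSwinnertonDyer.Theses.KolyvaginRoadThree.PoitouTateShaTateDualFact :=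
  fun K _ _ => Literature.NumberTheory.GaloisCohomology.poitouTate_sha_tateDual_holds K

end Summit.BirchSwinnertonDyer.BirchSwinnertonDyer.Theorems.EulerHalvesPT2

end
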